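import Summits.BirchSwinnertonDyer.BirchSwinnertonDyer.Theorems.PrintCf2SplitBadTwoF3LevelLift
import Summits.BirchSwinnertonDyer.Rank1Residual.X11b.KummerTorsionDecomposition
import Summits.BirchSwinnertonDyer.Rank1Residual.X11b.LevelShiftMaps
import Summits.BirchSwinnertonDyer.Rank1Residual.X11b.BDPRouteLevelToKummer
import Summits.BirchSwinnertonDyer.Rank1Residual.X11b.KummerLocalTorsionSaturation
import Literature.NumberTheory.EllipticCurves.CasselsTateLemma615
import HarnessLib

/-!
# Crux `PrintCf2.SplitBadTwoRankOneOfFacts` (stmt-BirchSwinnertonDyer-20368), road α v10.3, S3c input (F3) — the LEVEL LIFT of the RELAXED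
# KUMMER GROUP: `res_{D_v}(Φ(H¹_{𝓚, ⊤ at v}(K, E[p^k]))) = loc_v(𝔖_{v̄}(K, W*))`, hence
# `#((ι_* ∘ H¹(ẽ) ∘ loc_v)(kummerOutside W (p^k) {v})) = #range(loc_v | 𝔖_{v̄}(K, W*))`

Cell `bsd-print-cf2`, EXTRA WIDTH seat `bsd-line-cf2-p1-w8` g3 (prover-bsd-line-cf2-p1-w8-g3-0); `--supports stmt-BirchSwinnertonDyer-20368`
(helper, Theses-free). HONEST FRAMING: nothing here closes the crux or a registered stub; BSD is not proved by any of this; no summit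
statement is proved by this seat. No definition, no named fact, no `sorry`, no kit. beyond-print theorem: no.

WHY («plain» road to hF3 of LEAD cut 14, this seat's p677570 + `…KummerOutsideEigen`): the EXACT relaxation index `[kummerOutside W (p^k) {v} : Sel^{(p^k)}(E/K)]`
is `#((ι_* ∘ H¹(ẽ) ∘ loc_v)(kummerOutside …))` (e′-singular vanishing) `= [E(K_v) : E(K) + p^k E(K_v)]` (Poitou–Tate, X11b). hF3 counts
`#range(loc_v | 𝔖_{v̄}(K, W*))` in Agboola's `H¹(⊤ ⊓ D_v, W*)`-currency. This file is the TRANSPORT between the two, built on -w5 g3's level lift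
`Φ = res_{Γ_K → ⊤} ∘ H¹(e) ∘ H¹(ι_k)` (p677230: `resOfLe_levelLift_eq_zero_iff`, `levelLift_mem_restrictedSelmerBase`, `exists_levelLift_eq_of_mem_restrictedSelmerBase`).
The new point is the inclusion `res_{D_v} Φ(KO_v) ⊆ res_{D_v}(𝔖_{v̄})`: a class `x` Kummer away from `v` is NOT torsion-Kummer at `v̄` (its class there
is that of an arbitrary local point `R`), but by the DENSITY of the Mordell–Weil line at `v̄` (p677570 `exists_pow_nsmul_eq_zsmul_add`:
`p^c R = M·P₀ + p^{k+c} R′`) the level-`(k+c)` class `ι_* x − κ_{k+c}(M P₀)` IS strict at `v̄`, so its lift lies in `𝔖_{v̄}`, and it has the same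
`res_{D_v} ∘ Φ` as `x` as soon as the e-part of the Kummer classes of `P₀` dies at `v` (the PINNING at `v`, displayed hypothesis `hpin`).

WHAT (generic: `K` totally complex, `V/K` elliptic, `p` prime with the places above `p` exactly `v ≠ v̄`, `W* = V.endEigenPrimaryTorsion p π r`, an
equivariant projector `e` with `e ∘ ι = id` and a level-`k` shadow `eN`):
* §1 `natCard_map_eq_of_ker_iff` (abstract: two homomorphisms with the same kernel on `G` have images of `S ≤ G` of the same size),
  `levelLift_map_levelIncl` (`Φ_{k+c}(H¹(ι) x) = Φ_k(x)`), `torsionStrict` bookkeeping.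
* §2 **`map_resOfLe_levelLift_kummerOutside_eq_range`** — `(kummerOutside V (p^k) {v}).map (res_{D_v} ∘ Φ_k) = range(res_{D_v} ∘ 𝔖_{v̄}(K,W*).subtype)`
  for `p^k · 𝔖_{v̄} = 0`, under density at `v̄` and `hpin`.
* §3 **`natCard_map_kummerOutside_eq_natCard_range_resOfLe`** — `#((ι_* ∘ H¹(eN) ∘ loc_v)(kummerOutside V (p^k) {v})) = #range(res_{D_v} ∘ 𝔖_{v̄}.subtype)`.
With `…KummerOutsideEigen.natCard_map_kummerOutside_eq_index_of_dense` (this seat): **`#range(loc_v | 𝔖_{v̄}(K, W*)) = [E(K_v) : E(K) + p^k E(K_v)]`**, the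
plain-road form of hF3 (on an S3c frame the right side is `2^{dep(P)} · [W*′(K_v) : W*′(K)] · [W*(K_v) : W*(K)] = 2^ℓ`, -w2 g11 / -w6 g3).
presearch: Greenberg LNM 1716 §5 (proof of Prop. 5.8, level lifting), JSW17 §3.3 — tree theorems (X11b, p677230); no new fact.

References: [GreenbergLNM1716] §5; [JetchevSkinnerWan2017] §3.3; [MilneADT2006] I §6 Prop. 6.9; [Agboola2007] §3, §6.
-/

noncomputable section

open scoped Classical

set_option linter.dupNamespace false
set_option autoImplicit false

open CategoryTheory Function Field NumberField IsDedekindDomain WeierstrassCurve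
open Literature.NumberTheory.EllipticCurves Literature.NumberTheory.EllipticCurves.GreenbergSelmer
open Literature.NumberTheory.EllipticCurves.Agboola2007
open Literature.NumberTheory.GaloisRepresentations
open Literature.NumberTheory.GaloisRepresentations.DiscreteGaloisModule (SelmerStructure)
open Literature.NumberTheory.GaloisCohomology
open scoped ContRepresentation
open Summit.BirchSwinnertonDyer.Rank1Residual.X11b
open Summit.BirchSwinnertonDyer.Rank1Residual.X11b.LocBridge
open Summit.BirchSwinnertonDyer.Rank1Residual.X11b.Levels
open Summit.BirchSwinnertonDyer.Rank1Residual.X11b.AcSelmer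
open Summit.BirchSwinnertonDyer.BirchSwinnertonDyer.Theorems.PrintCf2
open Summit.BirchSwinnertonDyer.BirchSwinnertonDyer.Theorems.PrintCf2.RestrictedSelmerPair

namespace Summit.BirchSwinnertonDyer.BirchSwinnertonDyer.Theorems.PrintCf2.SelmerLocImage

/-! ## §1. Bookkeeping -/

section Abstract

/-- Two homomorphisms with the same vanishing locus have images of every subgroup of the same cardinality (both are the index of the
common kernel). [folklore] -/
theorem natCard_map_eq_of_ker_iff {G A B : Type*} [AddCommGroup G] [AddCommGroup A] [AddCommGroup B] (f : G →+ A) (g : G →+ B)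
    (h : ∀ x, f x = 0 ↔ g x = 0) (S : AddSubgroup G) : Nat.card (S.map f) = Nat.card (S.map g) := by
  have hker : f.ker = g.ker := by
    ext x
    rw [AddMonoidHom.mem_ker, AddMonoidHom.mem_ker, h]
  rw [← AddSubgroup.relIndex_ker, ← AddSubgroup.relIndex_ker, hker]

end Abstract

section LevelLift

variable {K : Type} [Field K] [NumberField K] (V : WeierstrassCurve K) [V.IsElliptic] (p : ℕ) [hp : Fact p.Prime]
  (π : V.endRing) (r : ℤ_[p]) (k : ℕ)
  (e : V.geomPrimaryTorsion p →+ ↥(V.endEigenPrimaryTorsion p π r))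
  (he : ∀ (σ : absoluteGaloisGroup K) (x : V.geomPrimaryTorsion p), e (σ • x) = σ • e x)

omit [NumberField K] [V.IsElliptic] in
/-- **Level compatibility of the lift: `Φ_{k+c}(H¹(ι) x) = Φ_k(x)`** (`ι_{k+c} ∘ ι = ι_k` on `E[p^∞]`, X11b `map_primaryInclusion_map_levelIncl`).
[cite: GreenbergLNM1716, §5 proof of Prop. 5.8] -/
theorem levelLift_map_levelIncl (c : ℕ) (x : galoisCohomology (V.torsionGaloisModule ((p ^ k : ℕ) : ℤ)) 1) :
    resH1Hom (Literature.NumberTheory.EllipticCurves.subgroupIncl (⊤ : Subgroup (absoluteGaloisGroup K)))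
        (AddMonoidHom.id ↥(V.endEigenPrimaryTorsion p π r)) (fun _ _ ↦ rfl)
        (resH1Hom (ContinuousMonoidHom.id (absoluteGaloisGroup K)) e (fun σ m ↦ he σ m)
          (toDiscreteH1 (isOpen_stabilizer_geomPrimaryTorsion V p)
            (galoisCohomology.map (primaryInclusion V p (k + c)) 1 (galoisCohomology.map (levelIncl V p k c) 1 x)))) =
      resH1Hom (Literature.NumberTheory.EllipticCurves.subgroupIncl (⊤ : Subgroup (absoluteGaloisGroup K)))
        (AddMonoidHom.id ↥(V.endEigenPrimaryTorsion p π r)) (fun _ _ ↦ rfl)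
        (resH1Hom (ContinuousMonoidHom.id (absoluteGaloisGroup K)) e (fun σ m ↦ he σ m)
          (toDiscreteH1 (isOpen_stabilizer_geomPrimaryTorsion V p) (galoisCohomology.map (primaryInclusion V p k) 1 x))) := by
  rw [map_primaryInclusion_map_levelIncl]

omit hp in
/-- **`H¹(ι|_E) κ_{k,E}(R) = κ_{k+c,E}(p^c R)`** for the level maps of X11b (`levelIncl` is the tree's `torsionInclusion`; X11b
`KummerDecomp.map_torsionInclusion_localKummerMap`). [cite: MilneADT2006, Ch. I §6, proof of Prop. 6.9] -/
theorem map_levelIncl_localKummerMap (c : ℕ) (E : Type) [Field E] [Algebra K E] [CharZero E]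
    (hk : ((p ^ k : ℕ) : ℤ) ≠ 0) (hkc : ((p ^ (k + c) : ℕ) : ℤ) ≠ 0) (R : (V.baseChange E).toAffine.Point) :
    galoisCohomology.map ((levelIncl V p k c).restrictField E) 1 (V.localKummerMap E hk R) =
      V.localKummerMap E hkc (((p ^ c : ℕ) : ℤ) • R) :=
  KummerDecomp.map_torsionInclusion_localKummerMap V E
    (Int.natCast_dvd_natCast.mpr (Nat.pow_dvd_pow p (Nat.le_add_right k c))) hk hkc
    (by rw [← Nat.cast_mul, ← pow_add, add_comm]) R

/-! ## §2. The transport `res_{D_v}(Φ_k(KO_v)) = res_{D_v}(𝔖_{v̄}(K, W*))` -/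

/-- **THE LEVEL LIFT OF THE RELAXED KUMMER GROUP.** `K` totally complex, places above `p` exactly `v ≠ v̄`, `p^k · 𝔖_{v̄}(K, W*) = 0`; density of the
Mordell–Weil line at `v̄` at scale `c` (p677570 `exists_pow_nsmul_eq_zsmul_add`: `p^c R = M·P₀ + p^{k+c} R′` for every local point `R`); PINNING at `v`
(`hpin`: the level-`(k+c)` lifts of the Kummer classes of the multiples of `P₀` die on `D_v` — e-Kummer at `v` is torsion). Then
**`res_{D_v}(Φ_k(kummerOutside V (p^k) {v})) = res_{D_v}(𝔖_{v̄}(K, W*))`** as subgroups of `H¹(⊤ ⊓ D_v, W*)`. `⊇`: -w5 g3's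
`exists_levelLift_eq_of_mem_restrictedSelmerBase` (torsion-Kummer ⊆ Kummer). `⊆`: for `x ∈ KO_v` with `loc_{v̄} x = κ_k(R)`, the class
`x′ = H¹(ι) x − κ_{k+c}(M P₀)` has `loc_{v̄} x′ = κ_{k+c}(p^c R − M P₀) = κ_{k+c}(p^{k+c} R′) = 0` and is Kummer = torsion-Kummer at `w ∤ p`, so
`Φ_{k+c} x′ ∈ 𝔖_{v̄}` (-w5 g3 `levelLift_mem_restrictedSelmerBase`) and `res_{D_v} Φ_{k+c} x′ = res_{D_v} Φ_k x` (`Φ_{k+c} ∘ H¹(ι) = Φ_k`, `hpin`).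
[cite: GreenbergLNM1716, §5 proof of Prop. 5.8] [cite: JetchevSkinnerWan2017, §3.3 (arXiv:1512.06894 p. 11)] [cite: MilneADT2006, Ch. I §6, Prop. 6.9] -/
theorem map_resOfLe_levelLift_kummerOutside_eq_range [IsTotallyComplex K]
    (he₁ : ∀ x : ↥(V.endEigenPrimaryTorsion p π r), e x = x)
    {v vbar : HeightOneSpectrum (𝓞 K)} (hv : ((p : ℕ) : 𝓞 K) ∈ v.asIdeal) (hne : vbar ≠ v)
    (hall : ∀ w : HeightOneSpectrum (𝓞 K), ((p : ℕ) : 𝓞 K) ∈ w.asIdeal → w = v ∨ w = vbar)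
    (hN : ∀ y ∈ restrictedSelmerBase ↥(V.endEigenPrimaryTorsion p π r) p vbar, p ^ k • y = 0)
    {c : ℕ} {P₀ : V.toAffine.Point}
    (hdense : ∀ R : (V.baseChange (vbar.adicCompletion K)).toAffine.Point,
      ∃ (M : ℤ) (R' : (V.baseChange (vbar.adicCompletion K)).toAffine.Point),
        p ^ c • R = M • Affine.Point.baseChange (W' := V) K (vbar.adicCompletion K) P₀ + p ^ (k + c) • R')
    (hpin : ∀ M : ℤ, resOfLe ↥(V.endEigenPrimaryTorsion p π r) (inf_le_left : (⊤ : Subgroup (absoluteGaloisGroup K)) ⊓ decomp v ≤ ⊤)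
      (resH1Hom (Literature.NumberTheory.EllipticCurves.subgroupIncl (⊤ : Subgroup (absoluteGaloisGroup K)))
        (AddMonoidHom.id ↥(V.endEigenPrimaryTorsion p π r)) (fun _ _ ↦ rfl)
        (resH1Hom (ContinuousMonoidHom.id (absoluteGaloisGroup K)) e (fun σ m ↦ he σ m)
          (toDiscreteH1 (isOpen_stabilizer_geomPrimaryTorsion V p) (galoisCohomology.map (primaryInclusion V p (k + c)) 1
            (kummerMapTorsion V ((p ^ (k + c) : ℕ) : ℤ) (V.zsmul_geomPoints_surjective_holds (NeZero.ne _)) (M • P₀)))))) = 0) :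
    (kummerOutside V (p ^ k) {Sum.inr v}).map
        ((resOfLe ↥(V.endEigenPrimaryTorsion p π r) (inf_le_left : (⊤ : Subgroup (absoluteGaloisGroup K)) ⊓ decomp v ≤ ⊤)).comp
          (((resH1Hom (Literature.NumberTheory.EllipticCurves.subgroupIncl (⊤ : Subgroup (absoluteGaloisGroup K)))
              (AddMonoidHom.id ↥(V.endEigenPrimaryTorsion p π r)) (fun _ _ ↦ rfl)).comp
            (resH1Hom (ContinuousMonoidHom.id (absoluteGaloisGroup K)) e (fun σ m ↦ he σ m))).comp
            ((toDiscreteH1 (isOpen_stabilizer_geomPrimaryTorsion V p)).toAddMonoidHom.comp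
              (galoisCohomology.map (primaryInclusion V p k) 1)))) =
      ((resOfLe ↥(V.endEigenPrimaryTorsion p π r) (inf_le_left : (⊤ : Subgroup (absoluteGaloisGroup K)) ⊓ decomp v ≤ ⊤)).comp
        (restrictedSelmerBase ↥(V.endEigenPrimaryTorsion p π r) p vbar).subtype).range := by
  have hM : ∀ m : V.geomPrimaryTorsion p, IsOpen {σ : absoluteGaloisGroup K | σ • m = m} := isOpen_stabilizer_geomPrimaryTorsion V p
  have hk0 : ((p ^ k : ℕ) : ℤ) ≠ 0 := NeZero.ne _
  have hkc0 : ((p ^ (k + c) : ℕ) : ℤ) ≠ 0 := NeZero.ne _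
  -- the torsion-strict structures at levels `k` and `k + c`
  let 𝓕k : SelmerStructure (V.torsionGaloisModule ((p ^ k : ℕ) : ℤ)) := fun pl ↦
    match pl with
    | Sum.inl _ => ⊤
    | Sum.inr w => (galoisCohomology.map ((primaryInclusion V p k).restrictField (w.adicCompletion K)) 1).ker
  let 𝓕kc : SelmerStructure (V.torsionGaloisModule ((p ^ (k + c) : ℕ) : ℤ)) := fun pl ↦
    match pl with
    | Sum.inl _ => ⊤
    | Sum.inr w => (galoisCohomology.map ((primaryInclusion V p (k + c)).restrictField (w.adicCompletion K)) 1).ker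
  have h𝓕k_inf : ∀ w : InfinitePlace K, 𝓕k (Sum.inl w) = ⊤ := fun _ ↦ rfl
  have h𝓕k : ∀ w : HeightOneSpectrum (𝓞 K), w ≠ v →
      𝓕k (Sum.inr w) = (galoisCohomology.map ((primaryInclusion V p k).restrictField (w.adicCompletion K)) 1).ker := fun _ _ ↦ rfl
  have h𝓕kc_inf : ∀ w : InfinitePlace K, 𝓕kc (Sum.inl w) = ⊤ := fun _ ↦ rfl
  have h𝓕kc : ∀ w : HeightOneSpectrum (𝓞 K), w ≠ v →
      𝓕kc (Sum.inr w) = (galoisCohomology.map ((primaryInclusion V p (k + c)).restrictField (w.adicCompletion K)) 1).ker :=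
    fun _ _ ↦ rfl
  -- the two lifts (as homomorphisms)
  set Φk : galoisCohomology (V.torsionGaloisModule ((p ^ k : ℕ) : ℤ)) 1 →+
      subgroupH1 (⊤ : Subgroup (absoluteGaloisGroup K)) ↥(V.endEigenPrimaryTorsion p π r) :=
    ((resH1Hom (Literature.NumberTheory.EllipticCurves.subgroupIncl (⊤ : Subgroup (absoluteGaloisGroup K)))
        (AddMonoidHom.id ↥(V.endEigenPrimaryTorsion p π r)) (fun _ _ ↦ rfl)).comp
      (resH1Hom (ContinuousMonoidHom.id (absoluteGaloisGroup K)) e (fun σ m ↦ he σ m))).comp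
      ((toDiscreteH1 hM).toAddMonoidHom.comp (galoisCohomology.map (primaryInclusion V p k) 1)) with hΦkdef
  have hΦk : ∀ x, Φk x = resH1Hom (Literature.NumberTheory.EllipticCurves.subgroupIncl (⊤ : Subgroup (absoluteGaloisGroup K)))
      (AddMonoidHom.id ↥(V.endEigenPrimaryTorsion p π r)) (fun _ _ ↦ rfl)
      (resH1Hom (ContinuousMonoidHom.id (absoluteGaloisGroup K)) e (fun σ m ↦ he σ m)
        (toDiscreteH1 hM (galoisCohomology.map (primaryInclusion V p k) 1 x))) := fun _ ↦ rfl
  set Φkc : galoisCohomology (V.torsionGaloisModule ((p ^ (k + c) : ℕ) : ℤ)) 1 →+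
      subgroupH1 (⊤ : Subgroup (absoluteGaloisGroup K)) ↥(V.endEigenPrimaryTorsion p π r) :=
    ((resH1Hom (Literature.NumberTheory.EllipticCurves.subgroupIncl (⊤ : Subgroup (absoluteGaloisGroup K)))
        (AddMonoidHom.id ↥(V.endEigenPrimaryTorsion p π r)) (fun _ _ ↦ rfl)).comp
      (resH1Hom (ContinuousMonoidHom.id (absoluteGaloisGroup K)) e (fun σ m ↦ he σ m))).comp
      ((toDiscreteH1 hM).toAddMonoidHom.comp (galoisCohomology.map (primaryInclusion V p (k + c)) 1)) with hΦkcdef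
  have hΦkc : ∀ x, Φkc x = resH1Hom (Literature.NumberTheory.EllipticCurves.subgroupIncl (⊤ : Subgroup (absoluteGaloisGroup K)))
      (AddMonoidHom.id ↥(V.endEigenPrimaryTorsion p π r)) (fun _ _ ↦ rfl)
      (resH1Hom (ContinuousMonoidHom.id (absoluteGaloisGroup K)) e (fun σ m ↦ he σ m)
        (toDiscreteH1 hM (galoisCohomology.map (primaryInclusion V p (k + c)) 1 x))) := fun _ ↦ rfl
  set resv := resOfLe ↥(V.endEigenPrimaryTorsion p π r) (inf_le_left : (⊤ : Subgroup (absoluteGaloisGroup K)) ⊓ decomp v ≤ ⊤) with hresv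
  have hvne : (Sum.inr vbar : Place K) ∉ ({Sum.inr v} : Finset (Place K)) := by
    rw [Finset.mem_singleton]
    exact fun h ↦ hne (Sum.inr_injective h)
  apply le_antisymm
  · -- `⊆`
    rintro _ ⟨x, hx, rfl⟩
    haveI : CharZero (vbar.adicCompletion K) := charZero_adicCompletion vbar
    have hxv : galoisCohomology.res (V.torsionGaloisModule ((p ^ k : ℕ) : ℤ)) (vbar.adicCompletion K) 1 x ∈
        V.kummerLocalConditionAt ((p ^ k : ℕ) : ℤ) (vbar.adicCompletion K) :=
      (mem_kummerOutside_iff V (p ^ k) {Sum.inr v} x).mp hx (Sum.inr vbar) hvne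
    rw [← V.range_localKummerMap (vbar.adicCompletion K) hk0] at hxv
    obtain ⟨R, hR⟩ := hxv
    obtain ⟨M, R', hMR⟩ := hdense R
    set x' : galoisCohomology (V.torsionGaloisModule ((p ^ (k + c) : ℕ) : ℤ)) 1 := galoisCohomology.map (levelIncl V p k c) 1 x -
      @id (galoisCohomology (V.torsionGaloisModule ((p ^ (k + c) : ℕ) : ℤ)) 1)
        (kummerMapTorsion V ((p ^ (k + c) : ℕ) : ℤ) (V.zsmul_geomPoints_surjective_holds (NeZero.ne _)) (M • P₀)) with hx'
    -- `x'` is torsion-Kummer away from `v`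
    have hx'𝓖 : x' ∈ SelmerStructure.selmerGroup (Function.update 𝓕kc (Sum.inr v : Place K) ⊤) := by
      rw [SelmerStructure.mem_selmerGroup_iff]
      rintro (w | w)
      · rw [Function.update_of_ne Sum.inl_ne_inr, h𝓕kc_inf]
        exact AddSubgroup.mem_top _
      · by_cases hw : w = v
        · subst hw
          rw [Function.update_self]
          exact AddSubgroup.mem_top _
        rw [Function.update_of_ne (fun h ↦ hw (Sum.inr_injective h)), h𝓕kc w hw]
        refine (AddMonoidHom.mem_ker).mpr ?_
        haveI : CharZero (w.adicCompletion K) := charZero_adicCompletion w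
        by_cases hwbar : w = vbar
        · -- at `v̄`: `loc x' = κ_{k+c}(p^c R − M P₀) = κ_{k+c}(p^{k+c} R′) = 0`
          subst hwbar
          have hloc : galoisCohomology.localization (V.torsionGaloisModule ((p ^ (k + c) : ℕ) : ℤ)) (Sum.inr w : Place K) 1 x' = 0 := by
            rw [hx', map_sub, id, localization_map_one]
            change galoisCohomology.map ((levelIncl V p k c).restrictField (w.adicCompletion K)) 1
                (galoisCohomology.res (V.torsionGaloisModule ((p ^ k : ℕ) : ℤ)) (w.adicCompletion K) 1 x) -
              galoisCohomology.res (V.torsionGaloisModule ((p ^ (k + c) : ℕ) : ℤ)) (w.adicCompletion K) 1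
                (kummerMapTorsion V ((p ^ (k + c) : ℕ) : ℤ) (V.zsmul_geomPoints_surjective_holds hkc0) (M • P₀)) = 0
            rw [← hR, map_levelIncl_localKummerMap V p k c (w.adicCompletion K) hk0 hkc0,
              KummerIndex.res_kummerMapTorsion_eq_localKummerMap V (w.adicCompletion K) hkc0, ← map_sub, ← AddMonoidHom.mem_ker,
              V.ker_localKummerMap (w.adicCompletion K) hkc0]
            refine ⟨R', ?_⟩
            have hb : Affine.Point.baseChange (W' := V) K (w.adicCompletion K) (M • P₀) =
                M • Affine.Point.baseChange (W' := V) K (w.adicCompletion K) P₀ := map_zsmul _ _ _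
            rw [zsmulAddGroupHom_apply, hb, natCast_zsmul, natCast_zsmul, eq_sub_iff_add_eq, add_comm, ← hMR]
          rw [hloc, map_zero]
        · -- at `w ∤ p`: Kummer = torsion-Kummer
          have hpw : ((p : ℕ) : 𝓞 K) ∉ w.asIdeal := fun h ↦ by
            rcases hall w h with h' | h'
            · exact hw h'
            · exact hwbar h'
          have hmem : galoisCohomology.localization (V.torsionGaloisModule ((p ^ (k + c) : ℕ) : ℤ)) (Sum.inr w : Place K) 1 x' ∈
              V.kummerLocalConditionAt ((p ^ (k + c) : ℕ) : ℤ) (w.adicCompletion K) := by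
            rw [hx', map_sub, id, localization_map_one]
            refine AddSubgroup.sub_mem _ ?_ ?_
            · have hxw : galoisCohomology.res (V.torsionGaloisModule ((p ^ k : ℕ) : ℤ)) (w.adicCompletion K) 1 x ∈
                  V.kummerLocalConditionAt ((p ^ k : ℕ) : ℤ) (w.adicCompletion K) :=
                (mem_kummerOutside_iff V (p ^ k) {Sum.inr v} x).mp hx (Sum.inr w)
                  (by rw [Finset.mem_singleton]; exact fun h ↦ hw (Sum.inr_injective h))
              rw [← V.range_localKummerMap (w.adicCompletion K) hk0] at hxw
              obtain ⟨Rw, hRw⟩ := hxw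
              change galoisCohomology.map ((levelIncl V p k c).restrictField (w.adicCompletion K)) 1
                (galoisCohomology.res (V.torsionGaloisModule ((p ^ k : ℕ) : ℤ)) (w.adicCompletion K) 1 x) ∈ _
              rw [← hRw, map_levelIncl_localKummerMap V p k c (w.adicCompletion K) hk0 hkc0]
              exact V.localKummerMap_mem _ hkc0 _
            · change galoisCohomology.res (V.torsionGaloisModule ((p ^ (k + c) : ℕ) : ℤ)) (w.adicCompletion K) 1 _ ∈ _
              rw [KummerIndex.res_kummerMapTorsion_eq_localKummerMap V (w.adicCompletion K) hkc0]
              exact V.localKummerMap_mem _ hkc0 _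
          rw [LevelKummer.kummerLocalConditionAt_eq_ker_map_primaryInclusion V p (k + c) w hpw hkc0] at hmem
          exact (AddMonoidHom.mem_ker).mp hmem
    have hs : Φkc x' ∈ restrictedSelmerBase ↥(V.endEigenPrimaryTorsion p π r) p vbar := by
      rw [hΦkc]
      exact levelLift_mem_restrictedSelmerBase V p π r (k + c) e he hv hne 𝓕kc h𝓕kc hx'𝓖
    refine ⟨⟨Φkc x', hs⟩, ?_⟩
    change resv (Φkc x') = resv (Φk x)
    have hlift : Φkc (galoisCohomology.map (levelIncl V p k c) 1 x) = Φk x := by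
      rw [hΦkc, hΦk]
      exact levelLift_map_levelIncl V p π r k e he c x
    have hpinM : resv (Φkc (kummerMapTorsion V ((p ^ (k + c) : ℕ) : ℤ) (V.zsmul_geomPoints_surjective_holds (NeZero.ne _)) (M • P₀))) = 0 := by
      rw [hΦkc]
      exact hpin M
    rw [hx', map_sub, id, hlift, map_sub, hpinM, sub_zero]
  · -- `⊇`
    rintro _ ⟨⟨y, hy⟩, rfl⟩
    obtain ⟨x, hx𝓖, hxy⟩ := exists_levelLift_eq_of_mem_restrictedSelmerBase V p π r k e he he₁ hall 𝓕k h𝓕k_inf h𝓕k hy (hN y hy)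
    refine ⟨x, ?_, ?_⟩
    · refine (mem_kummerOutside_iff V (p ^ k) {Sum.inr v} x).mpr ?_
      rintro (w | w) hw
      · -- complex place: `H¹ = 0`
        have htop := LocBridge.eq_top_of_isComplex (V.torsionGaloisModule ((p ^ k : ℕ) : ℤ)) (IsTotallyComplex.isComplex w)
          (V.kummerSelmerStructure ((p ^ k : ℕ) : ℤ) (Sum.inl w))
        change _ ∈ V.kummerSelmerStructure ((p ^ k : ℕ) : ℤ) (Sum.inl w)
        rw [htop]
        exact AddSubgroup.mem_top _
      · have hwv : w ≠ v := fun h ↦ hw (by rw [h, Finset.mem_singleton])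
        have h := (SelmerStructure.mem_selmerGroup_iff _ x).mp hx𝓖 (Sum.inr w)
        rw [Function.update_of_ne (fun h' ↦ hwv (Sum.inr_injective h')), h𝓕k w hwv] at h
        exact LevelKummer.ker_map_primaryInclusion_le_kummerLocalConditionAt V p k (w.adicCompletion K) h
    · change resv (Φk x) = resv y
      rw [hΦk, hxy]

/-! ## §3. The count: `#((ι_* ∘ H¹(eN) ∘ loc_v)(KO_v)) = #loc_v(𝔖_{v̄}(K, W*))` -/

/-- **`#((ι_* ∘ H¹(eN) ∘ loc_v)(kummerOutside V (p^k) {v})) = #range(res_{D_v} ∘ 𝔖_{v̄}(K, W*).subtype)`**: the X11b-level count of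
`…KummerOutsideEigen.relIndex_selmerGroup_kummerOutside_eq_natCard_map` (this seat) equals the quantity of hF3 (cut 14) — `ι_* H¹(eN) loc_v x = 0 ↔
res_{D_v} Φ_k x = 0` (-w5 g3 `resOfLe_levelLift_eq_zero_iff`, p677230) and §2. Consequently, with p677570 and `…KummerOutsideEigen` §4:
`#range(loc_v | 𝔖_{v̄}(K, W*)) = [E(K_v) : E(K) + p^k E(K_v)]` at every deep level (the plain-road form of hF3).
[cite: GreenbergLNM1716, §5 proof of Prop. 5.8] [cite: MilneADT2006, Ch. I, Thm. 4.10(b) and §6 Prop. 6.9] -/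
theorem natCard_map_kummerOutside_eq_natCard_range_resOfLe [IsTotallyComplex K]
    (he₁ : ∀ x : ↥(V.endEigenPrimaryTorsion p π r), e x = x)
    (eN : (V.torsionGaloisModule ((p ^ k : ℕ) : ℤ)).toContRepresentation →ⁱL (V.torsionGaloisModule ((p ^ k : ℕ) : ℤ)).toContRepresentation)
    (heN : ∀ y, primaryInclusion V p k (eN y) = (e (primaryInclusion V p k y) : V.geomPrimaryTorsion p))
    {v vbar : HeightOneSpectrum (𝓞 K)} (hv : ((p : ℕ) : 𝓞 K) ∈ v.asIdeal) (hne : vbar ≠ v)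
    (hall : ∀ w : HeightOneSpectrum (𝓞 K), ((p : ℕ) : 𝓞 K) ∈ w.asIdeal → w = v ∨ w = vbar)
    (hN : ∀ y ∈ restrictedSelmerBase ↥(V.endEigenPrimaryTorsion p π r) p vbar, p ^ k • y = 0)
    {c : ℕ} {P₀ : V.toAffine.Point}
    (hdense : ∀ R : (V.baseChange (vbar.adicCompletion K)).toAffine.Point,
      ∃ (M : ℤ) (R' : (V.baseChange (vbar.adicCompletion K)).toAffine.Point),
        p ^ c • R = M • Affine.Point.baseChange (W' := V) K (vbar.adicCompletion K) P₀ + p ^ (k + c) • R')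
    (hpin : ∀ M : ℤ, resOfLe ↥(V.endEigenPrimaryTorsion p π r) (inf_le_left : (⊤ : Subgroup (absoluteGaloisGroup K)) ⊓ decomp v ≤ ⊤)
      (resH1Hom (Literature.NumberTheory.EllipticCurves.subgroupIncl (⊤ : Subgroup (absoluteGaloisGroup K)))
        (AddMonoidHom.id ↥(V.endEigenPrimaryTorsion p π r)) (fun _ _ ↦ rfl)
        (resH1Hom (ContinuousMonoidHom.id (absoluteGaloisGroup K)) e (fun σ m ↦ he σ m)
          (toDiscreteH1 (isOpen_stabilizer_geomPrimaryTorsion V p) (galoisCohomology.map (primaryInclusion V p (k + c)) 1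
            (kummerMapTorsion V ((p ^ (k + c) : ℕ) : ℤ) (V.zsmul_geomPoints_surjective_holds (NeZero.ne _)) (M • P₀)))))) = 0) :
    Nat.card ((kummerOutside V (p ^ k) {Sum.inr v}).map
        (((galoisCohomology.map ((primaryInclusion V p k).restrictField (Place.Completion (Sum.inr v : Place K))) 1).comp
          ((galoisCohomology.map (eN.restrictField (Place.Completion (Sum.inr v : Place K))) 1).comp
            (galoisCohomology.localization (V.torsionGaloisModule ((p ^ k : ℕ) : ℤ)) (Sum.inr v) 1))))) =
      Nat.card ((resOfLe ↥(V.endEigenPrimaryTorsion p π r) (inf_le_left : (⊤ : Subgroup (absoluteGaloisGroup K)) ⊓ decomp v ≤ ⊤)).comp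
        (restrictedSelmerBase ↥(V.endEigenPrimaryTorsion p π r) p vbar).subtype).range := by
  rw [← map_resOfLe_levelLift_kummerOutside_eq_range V p π r k e he he₁ hv hne hall hN hdense hpin]
  refine natCard_map_eq_of_ker_iff _ _ (fun x ↦ ?_) _
  exact (resOfLe_levelLift_eq_zero_iff V p π r k e he he₁ eN heN v x).symm

end LevelLift

end Summit.BirchSwinnertonDyer.BirchSwinnertonDyer.Theorems.PrintCf2.SelmerLocImage

end
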